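import Mathlib
import Summits.KontsevichZagierPeriods.KontsevichZagierPeriods.Theorems.FermatIsogenyBetaLinearSectorQuartersStubQuarticLorentz
import HarnessLib

/-!
# `BetaLinearSector` (stmt-KontsevichZagierPeriods-3897), line `fermat-sector-transport` —
# stub `stub_affineEven_equivalent_lorentz` (Euler's reflection at `1/6`, step 4a)

The LEVEL-6 rung (`a, b, a', b' ∈ ⅙ℤ`) of the crux `BetaLinearSector` (route FermatIsogeny) needs
Euler's reflection formula at `1/6`, `sin(π/6) · B(1/6, 5/6) = π`, INSIDE the Kontsevich–Zagier
calculus.  After the sextic parametrisation, the fold at `1/2` and an affine move (the neighbouring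
stubs), the cell is
`[(0,1), 12(1+6v²+v⁴)/((1+v²)(1+14v²+v⁴))] = [(0,1), 4/(1+v²)] + [(0,1), 8(1+v²)/(1+14v²+v⁴)]`.
This file carries the SECOND summand onto the half-line Lorentzian:

* `stub_affineEven_equivalent_lorentz` — ONE change of variables (rule 2)),
  `u = φ(v) = 4v/(1 - v²)` from `(0,1)` onto `(0,∞)` (strictly increasing, `φ(0) = 0`,
  `φ → +∞` at `1⁻`), with `φ'(v) = 4(1+v²)/(1-v²)²` and the KEY IDENTITY
  `(1-v²)² + 16v² = 1 + 14v² + v⁴`, i.e. `1 + φ(v)² = (1+14v²+v⁴)/(1-v²)²`; hence the pull-back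
  `(2/(1+φ²))·φ' = 8(1+v²)/(1+14v²+v⁴)`: `V ∼ L = [(0,∞), 2/(1+u²)]`.

The map `φ` is a `ℚ`-rational function (`isSemialgebraicFunOn_ratFun₁`); its inverse on `(0,∞)` is
the explicit root `v = u/(2 + √(4+u²))` of the quadratic `u·v² + 4v - u = 0`.  The packaging is
the one-dimensional rule (2) `of_sub_of_mem_changeOfVariablesRel_dimOne`, exactly as in the
level-4 template `Quarters.stub_quarticHalf_equivalent_lorentz`.  All representations are PINNED
by their domain and their integrand on it.

## References

* M. Kontsevich, D. Zagier, *Periods* (2001), §1.2 rule (2).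
* G. Andrews, R. Askey, R. Roy, *Special Functions* (1999), Thm. 1.2.1 (Euler's reflection formula).
-/

noncomputable section

namespace Summit.KontsevichZagierPeriods.FermatIsogeny.BetaLinearSector.Sixths

open Set MeasureTheory
open MvPolynomial (aeval X C)
open Literature.NumberTheory.Transcendental Literature.NumberTheory.Transcendental.KZ
open Literature.ModelTheory.ExponentialFields (IsSemialgebraic)
open Summit.KontsevichZagierPeriods.HermiteRigidity.CMTwistQuasiPeriodTransfer
  (of_sub_of_mem_changeOfVariablesRel_dimOne image_fin_one)
open Summit.KontsevichZagierPeriods.KontsevichZagierPeriods.Theorems.GKZLevelThree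
  (isSemialgebraicFunOn_ratFun₁)

/-! ## The substitution `φ(v) = 4v/(1 - v²)` -/

/-- The derivative of `φ(v) = 4v/(1-v²)` is `4(1+v²)/(1-v²)²` (`v² ≠ 1`). [folklore] -/
theorem affEven_hasDerivAt_subst {v : ℝ} (hv : 1 - v ^ 2 ≠ 0) :
    HasDerivAt (fun v : ℝ => 4 * v / (1 - v ^ 2)) (4 * (1 + v ^ 2) / (1 - v ^ 2) ^ 2) v := by
  have h1 : HasDerivAt (fun v : ℝ => 4 * v) 4 v := by
    simpa using (hasDerivAt_id' v).const_mul (4:ℝ)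
  have h2 : HasDerivAt (fun v : ℝ => 1 - v ^ 2) (-(2 * v)) v := by
    simpa using (hasDerivAt_pow 2 v).const_sub (1:ℝ)
  exact (h1.div h2 hv).congr_deriv (by ring)

/-- The key identity `1 + φ(v)² = (1+14v²+v⁴)/(1-v²)²`, i.e. `(1-v²)² + 16v² = 1 + 14v² + v⁴`.
[folklore] -/
theorem affEven_one_add_subst_sq {v : ℝ} (hv : 1 - v ^ 2 ≠ 0) :
    1 + (4 * v / (1 - v ^ 2)) ^ 2 = (1 + 14 * v ^ 2 + v ^ 4) / (1 - v ^ 2) ^ 2 := by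
  have hD : (1 - v ^ 2) ^ 2 ≠ 0 := pow_ne_zero 2 hv
  rw [div_pow, eq_div_iff hD, add_mul, one_mul, div_mul_cancel₀ _ hD]
  ring

/-- `φ` is positive on `(0, 1)`. [folklore] -/
theorem affEven_subst_pos {v : ℝ} (hv0 : 0 < v) (hv1 : v < 1) : 0 < 4 * v / (1 - v ^ 2) :=
  div_pos (by linarith) (by nlinarith)

/-- `φ` is injective on `(0, 1)`: `φ(p) = φ(q)` forces `(p-q)(1+pq) = 0`, and `1+pq > 0` there.
[folklore] -/
theorem affEven_subst_injective {p q : ℝ} (hp : 0 < p ∧ p < 1) (hq : 0 < q ∧ q < 1)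
    (h : 4 * p / (1 - p ^ 2) = 4 * q / (1 - q ^ 2)) : p = q := by
  have hp' : (1 - p ^ 2) ≠ 0 := (by nlinarith [hp.1, hp.2] : (0:ℝ) < 1 - p ^ 2).ne'
  have hq' : (1 - q ^ 2) ≠ 0 := (by nlinarith [hq.1, hq.2] : (0:ℝ) < 1 - q ^ 2).ne'
  rw [div_eq_div_iff hp' hq'] at h
  have h0 : 4 * ((p - q) * (1 + p * q)) = 0 := by linear_combination h
  rcases mul_eq_zero.1 h0 with h1 | h1
  · norm_num at h1
  · rcases mul_eq_zero.1 h1 with h2 | h2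
    · linarith
    · have : 0 < p * q := mul_pos hp.1 hq.1
      linarith

/-- `φ` maps `(0, 1)` ONTO `(0, ∞)`: for `u > 0` the quadratic `u·v² + 4v - u = 0` has the root
`v = u/(2 + √(4+u²)) ∈ (0, 1)`. [folklore] -/
theorem affEven_exists_subst_eq {u : ℝ} (hu : 0 < u) :
    ∃ v : ℝ, 0 < v ∧ v < 1 ∧ 4 * v / (1 - v ^ 2) = u := by
  set d := Real.sqrt (4 + u ^ 2) with hd_def
  have hd0 : 0 ≤ d := Real.sqrt_nonneg _
  have hd2 : d ^ 2 = 4 + u ^ 2 := Real.sq_sqrt (by positivity)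
  have hud : u < d + 2 := by nlinarith
  have hd2pos : 0 < d + 2 := by linarith
  have hne : d + 2 ≠ 0 := hd2pos.ne'
  refine ⟨u / (d + 2), div_pos hu hd2pos, (div_lt_one hd2pos).2 hud, ?_⟩
  have h1 : 1 - (u / (d + 2)) ^ 2 = 4 / (d + 2) := by
    field_simp
    linear_combination hd2
  rw [h1]
  field_simp

/-- The image of `(0, 1)` under `φ` is `(0, ∞)`. [folklore] -/
theorem affEven_image_subst :
    (fun v : ℝ => 4 * v / (1 - v ^ 2)) '' Ioo 0 1 = Ioi 0 := by
  ext u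
  constructor
  · rintro ⟨v, hv, rfl⟩
    exact affEven_subst_pos hv.1 hv.2
  · intro hu
    obtain ⟨v, hv0, hv1, hvu⟩ := affEven_exists_subst_eq (u := u) hu
    exact ⟨v, ⟨hv0, hv1⟩, hvu⟩

/-- The pull-back identity of step 4a: for `0 < v < 1`,
`(2/(1+φ(v)²)) · |φ'(v)| = 8(1+v²)/(1+14v²+v⁴)`. [folklore] -/
theorem affEven_pullback {v : ℝ} (hv : 0 < v ∧ v < 1) :
    2 / (1 + (4 * v / (1 - v ^ 2)) ^ 2) * |4 * (1 + v ^ 2) / (1 - v ^ 2) ^ 2| =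
      8 * (1 + v ^ 2) / (1 + 14 * v ^ 2 + v ^ 4) := by
  obtain ⟨hv0, hv1⟩ := hv
  have hD : 0 < 1 - v ^ 2 := by nlinarith
  have hN : 0 < 1 + v ^ 2 := by positivity
  have hQ : 0 < 1 + 14 * v ^ 2 + v ^ 4 := by positivity
  rw [abs_of_pos (div_pos (by positivity) (pow_pos hD 2)), affEven_one_add_subst_sq hD.ne',
    div_div_eq_mul_div]
  field_simp
  ring

/-! ## Step 4a: `V ∼ L` by ONE change of variables -/

/-- **Step 4a of Euler's reflection at `1/6`.**
`[(0,1), 8(1+v²)/(1+14v²+v⁴)] ∼ [(0,∞), 2/(1+u²)]` by ONE change of variables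
`u = φ(v) = 4v/(1-v²)` (rule 2)): a `ℚ`-rational function, injective on `(0,1)` with image
`(0,∞)`, derivative `4(1+v²)/(1-v²)² > 0`, and the pull-back identity `affEven_pullback`
(`1 + φ² = (1+14v²+v⁴)/(1-v²)²`). [cite: KontsevichZagier2001, §1.2 rule (2)] -/
theorem stub_affineEven_equivalent_lorentz : ∀ (V L : KZ.IntegralRep 1), V.domain = {x | x 0 ∈ Set.Ioo (0:ℝ) 1} → Set.EqOn V.integrand (fun x => 8 * (1 + (x 0) ^ 2) / (1 + 14 * (x 0) ^ 2 + (x 0) ^ 4)) V.domain → L.domain = {x | 0 < x 0} → Set.EqOn L.integrand (fun x => 2 / (1 + (x 0) ^ 2)) L.domain → KZ.Equivalent V L := by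
  intro V L hVd hVi hLd hLi
  set φ : ℝ → ℝ := fun v => 4 * v / (1 - v ^ 2) with hφ
  set φ' : ℝ → ℝ := fun v => 4 * (1 + v ^ 2) / (1 - v ^ 2) ^ 2 with hφ'
  have hmem : ∀ p ∈ V.domain, 0 < p 0 ∧ p 0 < 1 := fun p hp => by rw [hVd] at hp; exact hp
  refine changeOfVariablesRel_subset_relations
    (of_sub_of_mem_changeOfVariablesRel_dimOne V L φ φ' ?_ ?_ ?_ ?_ ?_)
  · -- semialgebraic: a `ℚ`-rational function of `p 0`, denominator `1 - v² ≠ 0` on `(0,1)`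
    refine isSemialgebraicFunOn_ratFun₁ V.isSemialgebraic_domain (C 4 * X 0) (1 - X 0 ^ 2) φ
      (fun x hx => ?_) (fun x _ => ?_)
    · simp only [map_sub, map_pow, MvPolynomial.aeval_X, map_one]
      have hx' := hmem x hx
      exact (by nlinarith [hx'.1, hx'.2] : (0:ℝ) < 1 - x 0 ^ 2).ne'
    · simp [hφ]
  · -- derivative
    intro p hp
    have hp' := hmem p hp
    exact affEven_hasDerivAt_subst (by nlinarith [hp'.1, hp'.2] : (0:ℝ) < 1 - p 0 ^ 2).ne'
  · -- injective
    intro p hp q hq h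
    exact affEven_subst_injective (hmem p hp) (hmem q hq) h
  · -- image
    rw [hLd, hVd]
    exact (image_fin_one affEven_image_subst).symm
  · -- integrands
    intro p hp
    have hp' := hmem p hp
    have hφp : (fun _ : Fin 1 => φ (p 0)) ∈ L.domain := by
      rw [hLd]
      exact affEven_subst_pos hp'.1 hp'.2
    rw [hVi hp, hLi hφp]
    exact (affEven_pullback hp').symm

end Summit.KontsevichZagierPeriods.FermatIsogeny.BetaLinearSector.Sixths

end
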